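import Summits.NavierStokesRegularity.NavierStokesRegularity.Theses.TypeIQuarterGate
import Summits.NavierStokesRegularity.NavierStokesRegularity.Theorems.TypeIQuarterGateQuarterLawTypeIStubLorentzCount
import HarnessLib

/-!
# `TypeIQuarterGate.LorentzCountTypeI` (item stmt-NavierStokesRegularity-24109): Lorentz bound ⇒
# scale-uniform concentration count

**Statement (the route decl, verbatim).** Under the hypotheses of `QuarterLawTypeI` (maximal classical
Leray–Hopf solution from a rapidly decaying datum with the sup-norm Type-I rate at `T`) plus a uniform
weak-`L³` bound on the slices, for every `η > 0` there are `N, r₀` with at most `N` pairwise-`2r`-separated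
points whose cylinders `Q_r(x,T)` carry `∫∫ |∇u|_F² ≥ η r`, at every scale `r ≤ r₀`.

PROOF: the by-name stub `CountQuarterLaw.stub_lorentzCount` (same statement): uniform local energy from the
Type-I rate (Seregin 2014 Prop. 3.11 (i)), localized smoothing (Barker–Prange 2020 Thm 1, tree
`SparseSieve.stub_smoothingEnvelope`) forcing `L³`-mass `> γ³` on `B(x, 2λr)` at the common time
`T − σλ²r²` near every concentrating centre, and weak-`L³` counting by dyadic levels with bounded overlap.

HONEST FRAMING: conditional bookkeeping; `LorentzUpgradeTypeI` (24108) and `QuarterLawTypeI` (23726) remain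
OPEN; nothing about Navier–Stokes regularity or blow-up is claimed. [cite: BarkerPrange2020, Thm 1]
[cite: AlbrittonBarker2019, Lemma 2.6]
-/

-- the problem directory repeats the summit name (`NavierStokesRegularity/NavierStokesRegularity`)
set_option linter.dupNamespace false

noncomputable section

namespace Summit.NavierStokesRegularity.NavierStokesRegularity.Theorems

/-- **Item stmt-NavierStokesRegularity-24109** (`TypeIQuarterGate.LorentzCountTypeI`): the Lorentz
(weak-`L³`) bound together with the sup-norm Type-I rate yields the scale-uniform ε-concentration count.
Bookkeeping along a hypothetical blow-up; nothing about Navier–Stokes regularity or blow-up is asserted.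
[cite: BarkerPrange2020, Thm 1] -/
theorem typeIQuarterGate_lorentzCountTypeI_proof :
    Summit.NavierStokesRegularity.NavierStokesRegularity.Theses.TypeIQuarterGate.LorentzCountTypeI := by
  unfold Summit.NavierStokesRegularity.NavierStokesRegularity.Theses.TypeIQuarterGate.LorentzCountTypeI
  exact CountQuarterLaw.stub_lorentzCount

end Summit.NavierStokesRegularity.NavierStokesRegularity.Theorems

end
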